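import Literature.Analysis.FluidPDE.NSHopfGalerkinLimit
import Literature.Analysis.FluidPDE.NSUniqueness2DProofs
import Literature.Analysis.FluidPDE.TwoHalfSection
import Literature.Analysis.FluidPDE.TwoHalfSpectralSplit

/-!
# Route TwoAndHalfD (AnomalousDissipation) — tools for the planar section of an `x₃`-invariant
# Hopf–Galerkin scheme (support of item `ScalarLift2halfDR`, stmt-AnomalousDissipation-14983)

Helper file (everything proved) for the repaired 2½-D lift `ScalarLift2halfDR`. The lift is built
from the tree's `x₃`-invariant Hopf–Galerkin scheme on `𝕋³`
(`Literature.Analysis.FluidPDE.exists_isHopfGalerkinScheme_invariant`, `NSHopfInvariant`); to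
identify the planar part of its Leray–Hopf limit with the given planar Leray–Hopf velocity one
needs the planar part to be Leray–Hopf on `𝕋²`, which follows once the planar sections of the
scheme form a two-dimensional Hopf–Galerkin scheme (`IsHopfGalerkinScheme.isLerayHopfOn_limit` is
dimension-free). This file provides the bookkeeping for that descent:

* Fourier coefficients of `2½`-dimensional fields `twoHalf V R = (V, R)∘π`: vanishing up and down,
  components (`mFourierCoeff_twoHalf_eq_zero`, `mFourierCoeff_eq_zero_of_twoHalf`,
  `mFourierCoeff_left_apply`, `mFourierCoeff_right_apply`);
* Galerkin modes lift (`isGalerkinMode_twoHalf_zero`: `(a, 0)∘π`) and descend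
  (`isGalerkinMode_left_of_twoHalf`);
* the tested Galerkin right-hand side of an invariant field against a lifted planar mode is the
  planar one (`galerkin_rhs_twoHalf_planar`), and against the field itself it is
  `-ν‖∇W‖₂² + ⟪Φ, W⟫` (`integral_galerkin_rhs_self`);
* generic tools: continuity in time of the band-limited spectral dissipation, `toReal` of set
  lower integrals as interval integrals, a squeeze lemma for derivatives.

References: Hopf 1951 §§2–4; Robinson–Rodrigo–Sadowski 2016, Thm. 4.4; Majda–Bertozzi 2002, §2.3.1
(two-and-a-half-dimensional flows); Bruè–De Lellis 2023, §3.1.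
-/

noncomputable section

open MeasureTheory Set Filter Topology Function UnitAddTorus
open scoped ENNReal NNReal InnerProductSpace
open Literature.Analysis.FunctionSpaces Literature.Analysis.FunctionSpaces.Torus
open Literature.Analysis.FluidPDE Literature.Analysis.FluidPDE.Torus

namespace Summit.AnomalousDissipation.AnomalousDissipation.Theorems

-- D-0017: single-problem summit ⇒ `Summit.AnomalousDissipation.AnomalousDissipation.…` by design.
set_option linter.dupNamespace false

/-! ## Fourier coefficients of `2½`-dimensional fields: band limitation up and down -/

section Coeff

variable {V : (UnitAddTorus (Fin 2)) → (EuclideanSpace ℝ (Fin 2))} {R : (UnitAddTorus (Fin 2)) → ℝ}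

/-- The coefficient of `(V,R)∘π` at `K` vanishes when `K₂ ≠ 0`, or when both planar coefficients
at `(K₀, K₁)` vanish. [folklore] -/
theorem mFourierCoeff_twoHalf_eq_zero (hV : Integrable V volume) (hR : Integrable R volume)
    {K : Fin 3 → ℤ}
    (h : K (Fin.last 2) ≠ 0 ∨
      (mFourierCoeff (EuclideanSpace.complexify ∘ V) (fun j => K (Fin.castSucc j)) = 0 ∧
        mFourierCoeff (fun y => (R y : ℂ)) (fun j => K (Fin.castSucc j)) = 0)) :
    mFourierCoeff (EuclideanSpace.complexify ∘ twoHalf V R) K = 0 := by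
  rw [mFourierCoeff_complexify_twoHalf hV hR]
  split_ifs with hK
  · rcases h with h | ⟨h1, h2⟩
    · exact absurd hK h
    · have he := enorm_sq_mFourierCoeff_pair hV hR (fun j => K (Fin.castSucc j))
      simp only [h1, h2, enorm_zero, zero_pow two_ne_zero, add_zero, pow_eq_zero_iff two_ne_zero,
        enorm_eq_zero] at he
      exact he
  · rfl

/-- If the coefficient of `(V,R)∘π` at `(k, 0)` vanishes, so do both planar coefficients at `k`. [folklore] -/
theorem mFourierCoeff_eq_zero_of_twoHalf (hV : Integrable V volume) (hR : Integrable R volume)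
    {k : Fin 2 → ℤ}
    (h : mFourierCoeff (EuclideanSpace.complexify ∘ twoHalf V R) (Fin.snoc (α := fun _ : Fin 3 => ℤ) k 0) = 0) :
    mFourierCoeff (EuclideanSpace.complexify ∘ V) k = 0 ∧ mFourierCoeff (fun y => (R y : ℂ)) k = 0 := by
  rw [mFourierCoeff_complexify_twoHalf hV hR,
    if_pos (show (Fin.snoc (α := fun _ : Fin 3 => ℤ) k 0 : Fin 3 → ℤ) (Fin.last 2) = 0 from Fin.snoc_last _ _)] at h
  simp only [Fin.snoc_castSucc] at h
  have he := enorm_sq_mFourierCoeff_pair hV hR k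
  rw [h, enorm_zero, zero_pow two_ne_zero] at he
  have he' := he.symm
  rw [add_eq_zero] at he'
  obtain ⟨h1, h2⟩ := he'
  rw [pow_eq_zero_iff two_ne_zero, enorm_eq_zero] at h1 h2
  exact ⟨h1, h2⟩

/-- The planar components of the coefficient of `(V,R)∘π` at `(k, 0)` are the coefficients of `V`
at `k`. [folklore] -/
theorem mFourierCoeff_left_apply (hV : Integrable V volume) (hR : Integrable R volume)
    (k : Fin 2 → ℤ) (j : Fin 2) :
    mFourierCoeff (EuclideanSpace.complexify ∘ V) k j =
      mFourierCoeff (EuclideanSpace.complexify ∘ twoHalf V R) (Fin.snoc (α := fun _ : Fin 3 => ℤ) k 0) (Fin.castSucc j) := by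
  rw [mFourierCoeff_complexify_twoHalf hV hR,
    if_pos (show (Fin.snoc (α := fun _ : Fin 3 => ℤ) k 0 : Fin 3 → ℤ) (Fin.last 2) = 0 from Fin.snoc_last _ _)]
  simp only [Fin.snoc_castSucc]
  have hP := integrable_complexify_pair hV hR
  have hVc : Integrable (EuclideanSpace.complexify ∘ V) volume := integrable_complexify_comp_iff.2 hV
  rw [mFourierCoeff_apply_euclidean hP, mFourierCoeff_apply_euclidean hVc]
  congr 1
  funext y
  simp only [Function.comp_apply, EuclideanSpace.complexify_apply, planarEmbed_apply_castSucc]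

/-- The vertical component of the coefficient of `(V,R)∘π` at `(k, 0)` is the coefficient of `R`
at `k`. [folklore] -/
theorem mFourierCoeff_right_apply (hV : Integrable V volume) (hR : Integrable R volume)
    (k : Fin 2 → ℤ) :
    mFourierCoeff (fun y => (R y : ℂ)) k =
      mFourierCoeff (EuclideanSpace.complexify ∘ twoHalf V R) (Fin.snoc (α := fun _ : Fin 3 => ℤ) k 0) (Fin.last 2) := by
  rw [mFourierCoeff_complexify_twoHalf hV hR,
    if_pos (show (Fin.snoc (α := fun _ : Fin 3 => ℤ) k 0 : Fin 3 → ℤ) (Fin.last 2) = 0 from Fin.snoc_last _ _)]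
  simp only [Fin.snoc_castSucc]
  have hP := integrable_complexify_pair hV hR
  rw [mFourierCoeff_apply_euclidean hP]
  congr 1

end Coeff

/-! ## Galerkin modes: lift and descent -/

section Modes

variable {V : (UnitAddTorus (Fin 2)) → (EuclideanSpace ℝ (Fin 2))} {R : (UnitAddTorus (Fin 2)) → ℝ}

/-- The Fourier coefficients of the zero scalar vanish. [folklore] -/
theorem mFourierCoeff_zero_scalar (k : Fin 2 → ℤ) :
    mFourierCoeff (fun _ : (UnitAddTorus (Fin 2)) => ((0 : ℝ) : ℂ)) k = 0 := by
  simp [mFourierCoeff]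

/-- **The planar lift of a Galerkin mode is a Galerkin mode**: `(a, 0)∘π` is smooth, divergence
free and band limited of the same order. [folklore] -/
theorem isGalerkinMode_twoHalf_zero {N : ℕ} {a : (UnitAddTorus (Fin 2)) → (EuclideanSpace ℝ (Fin 2))} (ha : IsGalerkinMode N a) :
    IsGalerkinMode N (twoHalf a 0) := by
  refine ⟨ha.isSmooth.twoHalf (isSmooth_const (0 : ℝ)), ha.isDivFree.twoHalf _, fun K hK => ?_⟩
  have hai : Integrable a volume := ha.isSmooth.continuous.integrable_unitAddTorus
  have h0i : Integrable (fun _ : (UnitAddTorus (Fin 2)) => (0 : ℝ)) volume := integrable_const _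
  refine mFourierCoeff_twoHalf_eq_zero (R := fun _ => 0) hai h0i ?_
  by_cases hK3 : K (Fin.last 2) = 0
  · right
    refine ⟨ha.mFourierCoeff_eq_zero ?_, mFourierCoeff_zero_scalar _⟩
    have hKeq : K = Fin.snoc (α := fun _ : Fin 3 => ℤ) (fun j => K (Fin.castSucc j)) 0 :=
      (snoc_init_of_apply_last_eq_zero hK3).symm
    have := freqNormSq_snoc_zero (fun j => K (Fin.castSucc j))
    rw [← hKeq] at this
    rwa [this] at hK
  · left; exact hK3

/-- **The planar section of an invariant Galerkin mode is a Galerkin mode** of the same order. [folklore] -/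
theorem isGalerkinMode_left_of_twoHalf {N : ℕ} (h : IsGalerkinMode N (twoHalf V R)) :
    IsGalerkinMode N V := by
  have hVs : IsSmooth V := isSmooth_left_of_twoHalf h.isSmooth
  have hRs : IsSmooth R := isSmooth_right_of_twoHalf h.isSmooth
  refine ⟨hVs, isDivFree_of_twoHalf h.isDivFree, fun k hk => ?_⟩
  refine (mFourierCoeff_eq_zero_of_twoHalf hVs.continuous.integrable_unitAddTorus
    hRs.continuous.integrable_unitAddTorus (h.mFourierCoeff_eq_zero ?_)).1
  rwa [freqNormSq_snoc_zero]

end Modes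

/-! ## Sectioning the tested Galerkin right-hand side -/

section Pairings

variable {V G a₂ : (UnitAddTorus (Fin 2)) → (EuclideanSpace ℝ (Fin 2))} {R H : (UnitAddTorus (Fin 2)) → ℝ}

/-- `2½`-dimensional fields with continuous data are continuous. [folklore] -/
theorem continuous_twoHalf (hV : Continuous V) (hR : Continuous R) : Continuous (twoHalf V R) := by
  rw [twoHalf_eq_comp]
  exact (planarEmbed.continuous.comp (hV.prodMk hR)).comp continuous_planarProj

/-- The gradient of the zero scalar vanishes. [folklore] -/
theorem gradient_zero_fun (y : (UnitAddTorus (Fin 2))) : Torus.gradient (0 : (UnitAddTorus (Fin 2)) → ℝ) y = 0 := by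
  unfold Torus.gradient Torus.liftAt
  simp [_root_.gradient]

/-- The Laplacian of the zero scalar vanishes. [folklore] -/
theorem laplacian_zero_fun (y : (UnitAddTorus (Fin 2))) : Torus.laplacian (0 : (UnitAddTorus (Fin 2)) → ℝ) y = 0 := by
  unfold Torus.laplacian Torus.liftAt
  simp

/-- **Pairings of `2½`-dimensional fields with planar lifts only see the planar sections**:
`∫ ⟪(V,R)∘π, (a,0)∘π⟫ = ∫ ⟪V, a⟫`. [folklore] -/
theorem integral_inner_twoHalf_twoHalf_zero (hV : Continuous V) (R : (UnitAddTorus (Fin 2)) → ℝ) (ha : Continuous a₂) :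
    ∫ x, ⟪twoHalf V R x, twoHalf a₂ 0 x⟫_ℝ = ∫ y, ⟪V y, a₂ y⟫_ℝ :=
  integral_inner_twoHalf_planar (hV.memLp_of_hasCompactSupport (HasCompactSupport.of_compactSpace _))
    (ha.memLp_of_hasCompactSupport (HasCompactSupport.of_compactSpace _)) R

/-- **The tested Galerkin right-hand side of an invariant field against a planar lift is the
planar tested right-hand side**:
`∫ (⟪W,(W·∇)A⟫ + ν⟪W,ΔA⟫ + ⟪Φ,A⟫) = ∫ (⟪V,(V·∇)a⟫ + ν⟪V,Δa⟫ + ⟪G,a⟫)` for `W = (V,R)∘π`,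
`Φ = (G,H)∘π`, `A = (a,0)∘π`. [folklore] -/
theorem galerkin_rhs_twoHalf_planar (hV : IsSmooth V) (hR : IsSmooth R) (hG : Continuous G)
    (hH : Continuous H) (ha : IsSmooth a₂) (ν : ℝ) :
    ∫ x, (⟪twoHalf V R x, Torus.convect (twoHalf V R) (twoHalf a₂ 0) x⟫_ℝ +
        ν * ⟪twoHalf V R x, Torus.laplacian (twoHalf a₂ 0) x⟫_ℝ + ⟪twoHalf G H x, twoHalf a₂ 0 x⟫_ℝ) =
      ∫ y, (⟪V y, Torus.convect V a₂ y⟫_ℝ + ν * ⟪V y, Torus.laplacian a₂ y⟫_ℝ + ⟪G y, a₂ y⟫_ℝ) := by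
  have h0s : IsSmooth (0 : (UnitAddTorus (Fin 2)) → ℝ) := isSmooth_const (0 : ℝ)
  have hWs : IsSmooth (twoHalf V R) := hV.twoHalf hR
  have hAs : IsSmooth (twoHalf a₂ (0 : (UnitAddTorus (Fin 2)) → ℝ)) := ha.twoHalf h0s
  have hWc := hWs.continuous
  have hΦc : Continuous (twoHalf G H) := continuous_twoHalf hG hH
  -- integrability of the three terms upstairs
  have i1 : Integrable (fun x => ⟪twoHalf V R x, Torus.convect (twoHalf V R) (twoHalf a₂ 0) x⟫_ℝ) volume :=
    (hWc.inner (hWs.convect hAs).continuous).integrable_unitAddTorus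
  have i2 : Integrable (fun x => ν * ⟪twoHalf V R x, Torus.laplacian (twoHalf a₂ 0) x⟫_ℝ) volume :=
    ((hWc.inner hAs.laplacian.continuous).integrable_unitAddTorus).const_mul ν
  have i3 : Integrable (fun x => ⟪twoHalf G H x, twoHalf a₂ 0 x⟫_ℝ) volume :=
    (hΦc.inner hAs.continuous).integrable_unitAddTorus
  -- and downstairs
  have j1 : Integrable (fun y => ⟪V y, Torus.convect V a₂ y⟫_ℝ) volume :=
    (hV.continuous.inner (hV.convect ha).continuous).integrable_unitAddTorus
  have j2 : Integrable (fun y => ν * ⟪V y, Torus.laplacian a₂ y⟫_ℝ) volume :=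
    ((hV.continuous.inner ha.laplacian.continuous).integrable_unitAddTorus).const_mul ν
  have j3 : Integrable (fun y => ⟪G y, a₂ y⟫_ℝ) volume := (hG.inner ha.continuous).integrable_unitAddTorus
  have i12 : Integrable (fun x => ⟪twoHalf V R x, Torus.convect (twoHalf V R) (twoHalf a₂ 0) x⟫_ℝ +
      ν * ⟪twoHalf V R x, Torus.laplacian (twoHalf a₂ 0) x⟫_ℝ) volume := i1.add i2
  have j12 : Integrable (fun y => ⟪V y, Torus.convect V a₂ y⟫_ℝ + ν * ⟪V y, Torus.laplacian a₂ y⟫_ℝ) volume :=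
    j1.add j2
  rw [integral_add i12 i3, integral_add i1 i2, integral_add j12 j3, integral_add j1 j2,
    integral_const_mul, integral_const_mul]
  -- term by term
  have e1 : ∫ x, ⟪twoHalf V R x, Torus.convect (twoHalf V R) (twoHalf a₂ 0) x⟫_ℝ = ∫ y, ⟪V y, Torus.convect V a₂ y⟫_ℝ := by
    rw [integral_inner_twoHalf_convect_eq_add (ha.isContDiff (by simp)) (h0s.isContDiff (by simp)) j1]
    · simp [gradient_zero_fun]
    · simp [gradient_zero_fun]
  have e2 : ∫ x, ⟪twoHalf V R x, Torus.laplacian (twoHalf a₂ 0) x⟫_ℝ = ∫ y, ⟪V y, Torus.laplacian a₂ y⟫_ℝ := by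
    rw [laplacian_twoHalf ha h0s]
    have h00 : Torus.laplacian (0 : (UnitAddTorus (Fin 2)) → ℝ) = 0 := funext fun y => laplacian_zero_fun y
    rw [h00]
    exact integral_inner_twoHalf_twoHalf_zero hV.continuous R ha.laplacian.continuous
  have e3 : ∫ x, ⟪twoHalf G H x, twoHalf a₂ 0 x⟫_ℝ = ∫ y, ⟪G y, a₂ y⟫_ℝ :=
    integral_inner_twoHalf_twoHalf_zero hG H ha.continuous
  rw [e1, e2, e3]

end Pairings

/-! ## Generic tools: continuity of the band-limited dissipation, `toReal` of set integrals,
the tested right-hand side against the field itself, and a squeeze lemma for derivatives -/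

section Generic

variable {d : Type*} [Fintype d] [DecidableEq d]

/-- **The spectral dissipation of a band-limited field with continuous space–time lift is
continuous in time** on `[0, ∞)` (a finite sum of continuous coefficient curves). [folklore] -/
theorem continuousOn_toReal_eGradNormSq_of_band_limited {W : ℝ → UnitAddTorus d → EuclideanSpace ℝ d}
    {M : ℕ} (hW : ContinuousOn (stLift W) (Ici 0 ×ˢ univ))
    (hband : ∀ t, 0 ≤ t → ∀ k, (M : ℝ) ^ 2 < freqNormSq k →
      mFourierCoeff (EuclideanSpace.complexify ∘ W t) k = 0) :
    ContinuousOn (fun t => (eGradNormSq (W t)).toReal) (Ici 0) := by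
  have hc : ∀ k, ContinuousOn (fun t => mFourierCoeff (EuclideanSpace.complexify ∘ W t) k) (Ici 0) :=
    fun k => continuousOn_mFourierCoeff_of_continuousOn_stLift hW k
  have hsum : ContinuousOn (fun t => 4 * Real.pi ^ 2 *
      ∑ k ∈ freqBall M, freqNormSq k * ‖mFourierCoeff (EuclideanSpace.complexify ∘ W t) k‖ ^ 2) (Ici 0) :=
    continuousOn_const.mul (continuousOn_finsetSum _ fun k _ => continuousOn_const.mul ((hc k).norm.pow 2))
  refine hsum.congr fun t ht => ?_
  have ht0 : 0 ≤ t := ht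
  simp only
  rw [eGradNormSq_eq_sum_of_band_limited (continuous_slice_of_continuousOn_stLift hW (mem_Ici.2 ht0))
    (hband t ht0), ENNReal.toReal_ofReal]
  have := freqNormSq_nonneg (d := d)
  exact mul_nonneg (by positivity) (Finset.sum_nonneg fun k _ => mul_nonneg (freqNormSq_nonneg k) (sq_nonneg _))

omit [Fintype d] [DecidableEq d] in
/-- `toReal` of a set lower integral over `(s, t)` of a finite, `toReal`-continuous family is the
interval integral of `toReal`. [folklore] -/
theorem toReal_setLIntegral_eq_intervalIntegral {D : ℝ → ℝ≥0∞} {s t : ℝ} (hst : s ≤ t)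
    (hfin : ∀ τ ∈ Icc s t, D τ ≠ ⊤) (hcont : ContinuousOn (fun τ => (D τ).toReal) (Icc s t)) :
    (∫⁻ τ in Ioo s t, D τ).toReal = ∫ τ in s..t, (D τ).toReal := by
  rw [intervalIntegral.integral_of_le hst, integral_Ioc_eq_integral_Ioo]
  have hint : IntegrableOn (fun τ => (D τ).toReal) (Ioo s t) :=
    (hcont.integrableOn_compact isCompact_Icc).mono_set Ioo_subset_Icc_self
  rw [integral_eq_lintegral_of_nonneg_ae (ae_of_all _ fun τ => ENNReal.toReal_nonneg) hint.aestronglyMeasurable]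
  congr 1
  refine setLIntegral_congr_fun measurableSet_Ioo fun τ hτ => ?_
  rw [ENNReal.ofReal_toReal (hfin τ (Ioo_subset_Icc_self hτ))]

/-- **The tested Galerkin right-hand side against the (smooth, divergence-free) field itself**:
`∫ (⟪W,(W·∇)W⟫ + ν⟪W,ΔW⟫ + ⟪Φ,W⟫) = -ν ‖∇W‖₂² + ∫⟪Φ, W⟫` (the transport term vanishes by
incompressibility, the viscous term is the dissipation). [folklore] -/
theorem integral_galerkin_rhs_self {W Φ : UnitAddTorus d → EuclideanSpace ℝ d} (hW : IsSmooth W)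
    (hdiv : IsDivFree W) (hΦ : Continuous Φ) (ν : ℝ) :
    ∫ x, (⟪W x, Torus.convect W W x⟫_ℝ + ν * ⟪W x, Torus.laplacian W x⟫_ℝ + ⟪Φ x, W x⟫_ℝ) =
      -(ν * (eGradNormSq W).toReal) + ∫ x, ⟪Φ x, W x⟫_ℝ := by
  have i1 : Integrable (fun x => ⟪W x, Torus.convect W W x⟫_ℝ) volume :=
    (hW.continuous.inner (hW.convect hW).continuous).integrable_unitAddTorus
  have i2 : Integrable (fun x => ν * ⟪W x, Torus.laplacian W x⟫_ℝ) volume :=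
    ((hW.continuous.inner hW.laplacian.continuous).integrable_unitAddTorus).const_mul ν
  have i3 : Integrable (fun x => ⟪Φ x, W x⟫_ℝ) volume := (hΦ.inner hW.continuous).integrable_unitAddTorus
  have i12 : Integrable (fun x => ⟪W x, Torus.convect W W x⟫_ℝ + ν * ⟪W x, Torus.laplacian W x⟫_ℝ) volume :=
    i1.add i2
  have hswap : ∫ x, ∑ i, ‖Torus.partialDeriv i W x‖ ^ 2 = ∑ i, ∫ x, ‖Torus.partialDeriv i W x‖ ^ 2 := by
    refine integral_finsetSum _ fun i _ => ?_
    have hc : Continuous fun x => ‖Torus.partialDeriv i W x‖ ^ 2 := ((hW.partialDeriv i).continuous.norm).pow 2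
    exact hc.integrable_unitAddTorus
  rw [integral_add i12 i3, integral_add i1 i2, integral_const_mul,
    integral_inner_self_convect_eq_zero_of_isWeaklyDivFree (hdiv.isWeaklyDivFree_holds hW) hW,
    integral_inner_laplacian_eq_neg_holds hW, gradNormSq_eq_toReal_eGradNormSq_holds hW |>.symm, gradNormSq,
    hswap]
  ring

omit [Fintype d] [DecidableEq d] in
/-- **Squeeze for derivatives**: a nonnegative function below a function vanishing to second
order at `t₀` (value `0`, derivative `0`) and vanishing at `t₀` has derivative `0` at `t₀`. [folklore] -/
theorem hasDerivAt_zero_of_squeeze {D D₃ : ℝ → ℝ} {t₀ : ℝ} (h0 : ∀ᶠ t in 𝓝 t₀, 0 ≤ D t)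
    (hle : ∀ᶠ t in 𝓝 t₀, D t ≤ D₃ t) (hD : D t₀ = 0) (hD₃ : D₃ t₀ = 0) (hd : HasDerivAt D₃ 0 t₀) :
    HasDerivAt D 0 t₀ := by
  rw [hasDerivAt_iff_isLittleO] at hd ⊢
  simp only [smul_zero, sub_zero, hD, hD₃] at hd ⊢
  refine Asymptotics.IsBigO.trans_isLittleO ?_ hd
  refine Asymptotics.IsBigO.of_bound 1 ?_
  filter_upwards [h0, hle] with t h0t hlet
  rw [Real.norm_eq_abs, Real.norm_eq_abs, one_mul, abs_of_nonneg h0t]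
  exact hlet.trans (le_abs_self _)

end Generic

end Summit.AnomalousDissipation.AnomalousDissipation.Theorems

end
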